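import Literature.AlgebraicGeometry.Motives.FaltingsECCardProofs
import Literature.NumberTheory.EllipticCurves.FrobeniusTateModuleProofs
import Literature.NumberTheory.EllipticCurves.FrobeniusTateModuleTraceProofs
import Literature.NumberTheory.EllipticCurves.FrobeniusSeparableProofs
import HarnessLib

/-!
# Tate's isogeny theorem `E ~ E' ↔ #E(k) = #E'(k)`: assembly from the named facts

Sibling proof file of `Literature.AlgebraicGeometry.Motives.FaltingsEC` and
`Literature.AlgebraicGeometry.Motives.FaltingsECCardProofs` (D-0014: `Literature/` is sorry-free,
cited results are named facts `def X : Prop`). `FaltingsECCardProofs` proves the named fact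
`Literature.Hodge.isIsogenous_iff_card_point_eq W W'` — two elliptic curves over a finite field `k` are
isogenous over `k` iff `#E(k) = #E'(k)` (J. Tate, Invent. Math. 2 (1966), §3 Thm. 1; Silverman,
*AEC*, 2nd ed., Exercise 5.4) — from Tate's theorem in Tate-module form and from the trace and
determinant of Frobenius on `T_ℓ E`, `T_ℓ E'` entering as hypotheses spelled out verbatim. This
file feeds those hypotheses with the tree's named facts, now that
`Literature.NumberTheory.EllipticCurves.FrobeniusTateModule` (the facts
`trace_galoisRepTate_frobenius`, `det_galoisRepTate_frobenius`: Silverman, Thm. V.2.3.1) and its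
reduction `Literature.NumberTheory.EllipticCurves.FrobeniusTateModuleProofs` are in the tree:

* `Literature.AlgebraicGeometry.Motives.isIsogenous_iff_card_point_eq_of_frobenius_facts`: the target from Tate's Main
  Theorem `mem_span_range_tateModule_map_of_equivariant_of_finite W W' ℓ` and the two V.2.3.1
  facts for `E` and `E'`, at one prime `ℓ ≠ char k`;
* `Literature.AlgebraicGeometry.Motives.isIsogenous_iff_card_point_eq_of_printed_facts`: **the target reduced to the
  printed inputs of its proof** — Tate's Main Theorem, and for each curve the Weil pairings on
  `E[ℓ^n]` (*AEC* Prop. III.8.1, `exists_weilPairing`), Prop. III.8.6 (`det ψ_ℓ = deg ψ`,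
  `Isogeny.det_tateModule_map_eq_deg`) and Thm. III.4.10(a) (`#ker ψ = deg_s ψ`,
  `Isogeny.card_ker_eq_finSepDegree`); Cor. III.5.5 (`1 - φ` separable) is proved
  (`isSeparable_oneSubFrobeniusIsogeny_holds`, `FrobeniusSeparableProofs`) — every step of
  Silverman's Exercise 5.4 → III.7.7(a), V.2.3.1, V.1.1 being machine-checked in
  `FaltingsECCardProofs`, `FrobeniusTateModuleProofs`, `FrobeniusEndomorphism`,
  `FrobeniusSeparableProofs` and `TateModuleDeterminantProofs`;
* `Literature.AlgebraicGeometry.Motives.isIsogenous_iff_card_point_eq_of_printed_facts_forall`: the same with the facts at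
  all primes (a prime `ℓ ∈ {2, 3}` different from `char k` exists), the shape of the eventual
  `isIsogenous_iff_card_point_eq_holds`.

`isIsogenous_iff_card_point_eq_holds` itself is not asserted: Tate's Main Theorem (the cited
paper's main result; its proof uses the abelian surface `E × E'`), the Weil pairing (III.8.1),
III.8.6 and III.4.10(a) remain named facts of the tree (at the time of Part 1; see Part 2).

## Part 2 (appended). Thm. V.2.3.1 proved: everything but Tate's theorem is now a theorem

The two V.2.3.1 facts are now theorems of the tree — `det_galoisRepTate_frobenius_holds`
(`FrobeniusTateModuleProofs`, Part 2: the Weil pairing, *AEC* III.8.1, is proved in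
`WeilPairingProofs`) and `trace_galoisRepTate_frobenius_holds`
(`Literature.NumberTheory.EllipticCurves.FrobeniusTateModuleTraceProofs`: from
`φ² - aφ + q = 0` in `End_k(E)`, proved by Manin's method in `FrobeniusManinProofs`, and the
determinant) — as is III.4.10(a) (`IsogenyDegreeKernelProofs`). Feeding them in:

* `Literature.AlgebraicGeometry.Motives.card_point_eq_of_isIsogenous` — **isogenous elliptic curves over a finite field
  have the same number of rational points, unconditionally** (Tate, Thm. 1, the easy
  implication; Silverman, *AEC*, Exercise 5.4(a)); more generally
  `Literature.AlgebraicGeometry.Motives.card_point_eq_of_exists_tateModule_hom_ne_zero`: a non-zero `Γ_k`-map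
  `T_ℓ E → T_ℓ E'` (not necessarily injective; any prime `ℓ`, also `ℓ = char k`) already forces
  `#E(k) = #E'(k)`, and conversely (`ℓ ≠ char k`)
  `Literature.AlgebraicGeometry.Motives.exists_tateModule_hom_ne_zero_of_card_point_eq`; together
  `Literature.AlgebraicGeometry.Motives.exists_tateModule_hom_ne_zero_iff_card_point_eq` — for elliptic curves, the
  equivalence of the Tate-module condition (b) and the characteristic-polynomial condition (c)
  of Tate's Thm. 1, unconditionally (`f_E = T² - aT + q` is determined by `#E(k) = q + 1 - a`).
* `Literature.AlgebraicGeometry.Motives.isIsogenous_of_card_point_eq_of_tate`, `…_of_isogenyTheorem` — the converse from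
  Tate's Main Theorem, resp. from Tate's isogeny theorem in Tate-module form, at one prime
  `ℓ ≠ char k`, with no other hypothesis.
* `Literature.Hodge.isIsogenous_iff_card_point_eq_of_tate_mainTheorem(_forall)` — **the named fact
  `isIsogenous_iff_card_point_eq W W'` from Tate's Main Theorem
  `mem_span_range_tateModule_map_of_equivariant_of_finite W W' ℓ` alone** (one prime `ℓ ≠ char k`,
  resp. all primes), and `…_of_isogenyTheorem(_forall)` from
  `isIsogenous_of_finite_iff_exists_tateModule_hom_ne_zero W W' ℓ` alone.
* `Literature.AlgebraicGeometry.Motives.isIsogenous_of_finite_iff_exists_tateModule_hom_ne_zero_of_isIsogenous_iff_card_point_eq` and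
  `…_iff_isIsogenous_iff_card_point_eq`: conversely the point-count fact gives the Tate-module
  fact at every prime, so **the two named facts `isIsogenous_iff_card_point_eq W W'` and
  `isIsogenous_of_finite_iff_exists_tateModule_hom_ne_zero W W' ℓ` (`ℓ ≠ char k`) are
  equivalent theorems-to-be**: what remains unproved of either is exactly Tate's existence
  statement "(b) ⇒ (a)": a non-zero `Γ_k`-map `T_ℓ E → T_ℓ E'` comes from an isogeny `E → E'`
  (Tate's proof: the Main Theorem for the abelian surface `E × E'`).

## References

* [Tate1966Endomorphisms] J. Tate, *Endomorphisms of abelian varieties over finite fields*,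
  Invent. Math. 2 (1966), 134–144: Main Theorem; §3, Theorem 1 (its conditions (a) isogeny,
  (b) Tate modules, (c) characteristic polynomials of Frobenius / zeta functions).
* [SilvermanAEC2009] J. H. Silverman, *The Arithmetic of Elliptic Curves*, 2nd ed., GTM 106,
  Springer 2009: Exercise 5.4 (PDF p. 139), Thm. III.7.7 (PDF p. 86), Prop. III.8.1,
  Prop. III.8.6 (PDF p. 92), Thm. III.4.10 (PDF p. 71), Cor. III.5.5 (PDF p. 76), Thm. V.1.1
  (PDF p. 126), Thm. V.2.3.1 (PDF pp. 129–130).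
-/

noncomputable section

open scoped Classical

universe u

namespace Literature.AlgebraicGeometry.Motives

open WeierstrassCurve

variable {K : Type u} [Field K] {W W' : WeierstrassCurve K} {ℓ : ℕ} [Fact ℓ.Prime]

/-- **Tate's isogeny theorem in point-count form, from the named facts** (one prime
`ℓ ≠ char k`): the named fact `isIsogenous_iff_card_point_eq W W'` follows from Tate's Main
Theorem `mem_span_range_tateModule_map_of_equivariant_of_finite W W' ℓ` (`FaltingsEC`; Tate 1966)
and the named facts `trace_galoisRepTate_frobenius`, `det_galoisRepTate_frobenius` of
`Literature.NumberTheory.EllipticCurves.FrobeniusTateModule` for `E` and `E'` (Silverman, *AEC*,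
Thm. V.2.3.1), by `isIsogenous_iff_card_point_eq_of_tate` (`FaltingsECCardProofs`).
[cite: Tate1966Endomorphisms, Main Theorem and Thm. 1] [cite: SilvermanAEC2009, Exercise 5.4] -/
theorem isIsogenous_iff_card_point_eq_of_frobenius_facts (hℓ : (ℓ : K) ≠ 0)
    (hT : mem_span_range_tateModule_map_of_equivariant_of_finite W W' ℓ)
    (htr : W.trace_galoisRepTate_frobenius ℓ) (hdet : W.det_galoisRepTate_frobenius ℓ)
    (htr' : W'.trace_galoisRepTate_frobenius ℓ) (hdet' : W'.det_galoisRepTate_frobenius ℓ) :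
    isIsogenous_iff_card_point_eq W W' :=
  isIsogenous_iff_card_point_eq_of_tate hℓ hT htr hdet htr' hdet'

/-- **Tate's isogeny theorem in point-count form, reduced to the printed inputs of its proof**
(one prime `ℓ ≠ char k`): `isIsogenous_iff_card_point_eq W W'` (Tate 1966, Thm. 1; Silverman,
*AEC*, Exercise 5.4) follows from
* Tate's Main Theorem (`hT`: `mem_span_range_tateModule_map_of_equivariant_of_finite W W' ℓ`),
and, for each of `E` and `E'`,
* the Weil pairings on `E[ℓ^n]`, `n ≥ 1` (`hW`: `exists_weilPairing`, *AEC* Prop. III.8.1),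
* *AEC* Prop. III.8.6, `det ψ_ℓ = deg ψ` (`h86`: `Isogeny.det_tateModule_map_eq_deg`),
* *AEC* Thm. III.4.10(a), `#ker ψ = deg_s ψ` (`h410`: `Isogeny.card_ker_eq_finSepDegree`),
while *AEC* Cor. III.5.5 (`1 - φ` separable) is the tree's theorem
`isSeparable_oneSubFrobeniusIsogeny_holds` (`FrobeniusSeparableProofs`) —
through `det_galoisRepTate_frobenius_of_exists_weilPairing'` and
`trace_galoisRepTate_frobenius_of_exists_weilPairing`
(`Literature.NumberTheory.EllipticCurves.FrobeniusTateModuleProofs`: Silverman's proofs of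
Thm. V.1.1 and Thm. V.2.3.1) and `isIsogenous_iff_card_point_eq_of_frobenius_facts`.
[cite: Tate1966Endomorphisms, Main Theorem and Thm. 1] [cite: SilvermanAEC2009, Exercise 5.4 with Thm. V.2.3.1] -/
theorem isIsogenous_iff_card_point_eq_of_printed_facts (hℓ : (ℓ : K) ≠ 0)
    (hT : mem_span_range_tateModule_map_of_equivariant_of_finite W W' ℓ)
    (hW : ∀ n : ℕ, W.exists_weilPairing (ℓ ^ (n + 1)))
    (hW' : ∀ n : ℕ, W'.exists_weilPairing (ℓ ^ (n + 1)))
    (h86 : Isogeny.det_tateModule_map_eq_deg W ℓ) (h86' : Isogeny.det_tateModule_map_eq_deg W' ℓ)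
    (h410 : Isogeny.card_ker_eq_finSepDegree W W) (h410' : Isogeny.card_ker_eq_finSepDegree W' W') :
    isIsogenous_iff_card_point_eq W W' :=
  isIsogenous_iff_card_point_eq_of_frobenius_facts hℓ hT
    (trace_galoisRepTate_frobenius_of_exists_weilPairing W ℓ hW h86 h410
      (isSeparable_oneSubFrobeniusIsogeny_holds W))
    (det_galoisRepTate_frobenius_of_exists_weilPairing' W ℓ hW)
    (trace_galoisRepTate_frobenius_of_exists_weilPairing W' ℓ hW' h86' h410'
      (isSeparable_oneSubFrobeniusIsogeny_holds W'))
    (det_galoisRepTate_frobenius_of_exists_weilPairing' W' ℓ hW')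

/-- **Tate's isogeny theorem in point-count form, reduced to the printed inputs at all primes**
(the shape of the eventual `isIsogenous_iff_card_point_eq_holds`; a prime `ℓ ∈ {2, 3}` with
`ℓ ≠ char k` exists, `exists_prime_natCast_ne_zero`).
[cite: Tate1966Endomorphisms, Main Theorem and Thm. 1] [cite: SilvermanAEC2009, Exercise 5.4 with Thm. V.2.3.1] -/
theorem isIsogenous_iff_card_point_eq_of_printed_facts_forall
    (hT : ∀ (ℓ : ℕ) [Fact ℓ.Prime], mem_span_range_tateModule_map_of_equivariant_of_finite W W' ℓ)
    (hW : ∀ m : ℕ, W.exists_weilPairing m) (hW' : ∀ m : ℕ, W'.exists_weilPairing m)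
    (h86 : ∀ (ℓ : ℕ) [Fact ℓ.Prime], Isogeny.det_tateModule_map_eq_deg W ℓ)
    (h86' : ∀ (ℓ : ℕ) [Fact ℓ.Prime], Isogeny.det_tateModule_map_eq_deg W' ℓ)
    (h410 : Isogeny.card_ker_eq_finSepDegree W W) (h410' : Isogeny.card_ker_eq_finSepDegree W' W') :
    isIsogenous_iff_card_point_eq W W' := by
  intro _ _ _
  obtain ⟨l, hl, hlK⟩ := exists_prime_natCast_ne_zero K
  haveI : Fact l.Prime := ⟨hl⟩
  exact isIsogenous_iff_card_point_eq_of_printed_facts hlK (hT l) (fun n ↦ hW _) (fun n ↦ hW' _)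
    (h86 l) (h86' l) h410 h410'

end Literature.AlgebraicGeometry.Motives

/-! ## Part 2 (appended). Thm. V.2.3.1 proved: everything but Tate's theorem is now a theorem -/

namespace Literature.AlgebraicGeometry.Motives

open WeierstrassCurve

variable {K : Type u} [Field K] {W W' : WeierstrassCurve K}

/-! ### A non-zero `Γ_k`-map of Tate modules forces equal point counts, and conversely -/

/-- **Intertwiners see the trace**: if `f ∘ A = A' ∘ f` for linear maps with `A² - aA + q = 0`
and `A'² - a'A' + q = 0` (same constant term), then `(a - a') • (f ∘ A) = 0` — apply `f` to
`A²x = aAx - qx` and compare with `A'²(fx) = a'A'(fx) - q(fx)`. [folklore] -/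
theorem smul_comp_eq_zero_of_comp_eq_comp {R : Type*} [CommRing R] {M M' : Type*}
    [AddCommGroup M] [Module R M] [AddCommGroup M'] [Module R M']
    {f : M →ₗ[R] M'} {A : M →ₗ[R] M} {A' : M' →ₗ[R] M'} {a a' q : R}
    (hcomm : f ∘ₗ A = A' ∘ₗ f) (hA : A * A - a • A + q • (1 : M →ₗ[R] M) = 0)
    (hA' : A' * A' - a' • A' + q • (1 : M' →ₗ[R] M') = 0) :
    (a - a') • (f ∘ₗ A) = 0 := by
  have hc : ∀ y, f (A y) = A' (f y) := fun y ↦ LinearMap.congr_fun hcomm y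
  refine LinearMap.ext fun x ↦ ?_
  have h1 := LinearMap.congr_fun hA x
  have h2 := LinearMap.congr_fun hA' (f x)
  simp only [LinearMap.sub_apply, LinearMap.add_apply, LinearMap.smul_apply, Module.End.mul_apply,
    Module.End.one_apply, LinearMap.zero_apply] at h1 h2
  have h3 : f (A (A x)) = a • f (A x) - q • f x := by
    have e : A (A x) = a • A x - q • x := by
      rw [← sub_eq_zero, ← h1]; abel
    rw [e, map_sub, map_smul, map_smul]
  have h4 : f (A (A x)) = a' • f (A x) - q • f x := by
    have e : A' (A' (f x)) = a' • A' (f x) - q • f x := by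
      rw [← sub_eq_zero, ← h2]; abel
    rw [hc, hc, e, ← hc]
  rw [LinearMap.smul_apply, LinearMap.comp_apply, LinearMap.zero_apply, sub_smul, sub_eq_zero]
  exact sub_left_injective (h3.symm.trans h4)

/-- **A non-zero `Γ_k`-equivariant `ℤ_ℓ`-linear map `T_ℓ E → T_ℓ E'` forces `#E(k) = #E'(k)`**
(`E, E'` elliptic over a finite field `k`; `f` need not be injective, and `ℓ` is *any* prime,
`ℓ = char k` included). With `φ_ℓ² - aφ_ℓ + q = 0` on `T_ℓ E` and `φ'_ℓ² - a'φ'_ℓ + q = 0` on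
`T_ℓ E'` (Thm. V.2.3.1(b) at every prime, `galoisRepTate_frobenius_sq_sub_smul_add_smul_eq_zero`,
proved) and `f φ_ℓ = φ'_ℓ f`: `(a - a') • (f ∘ φ_ℓ) = 0` (`smul_comp_eq_zero_of_comp_eq_comp`),
and `f ∘ φ_ℓ ≠ 0` as `φ_ℓ = ρ(σ_q)` is invertible, so `a = a'` (`T_ℓ E'` is torsion-free). For
elliptic curves and `ℓ ≠ char k` this is the implication (b) ⇒ (c) of Tate, Thm. 1 (there:
`V_ℓ(E')` `G`-isomorphic to a `G`-subspace of `V_ℓ(E)` implies `f_{E'} | f_E`), with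
`f_E = T² - aT + q`, `a = q + 1 - #E(k)`.
[cite: Tate1966Endomorphisms, Thm. 1] [cite: SilvermanAEC2009, Exercise 5.4(a) with Thm. V.2.3.1] -/
theorem card_point_eq_of_exists_tateModule_hom_ne_zero [Finite K] [W.IsElliptic] [W'.IsElliptic]
    {ℓ : ℕ} [Fact ℓ.Prime] {f : W.tateModule ℓ →ₗ[ℤ_[ℓ]] W'.tateModule ℓ} (hf0 : f ≠ 0)
    (hf : ∀ (σ : Field.absoluteGaloisGroup K) (x : W.tateModule ℓ), f (σ • x) = σ • f x) :
    Nat.card W.toAffine.Point = Nat.card W'.toAffine.Point := by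
  obtain ⟨τ, hτ⟩ := exists_frobenius K
  haveI := module_free_tateModule_holds W' ℓ
  have hcomm : f ∘ₗ W.galoisRepTate ℓ τ = W'.galoisRepTate ℓ τ ∘ₗ f :=
    LinearMap.ext fun x ↦ by
      simpa only [LinearMap.comp_apply, galoisRepTate_apply_apply] using hf τ x
  have key := smul_comp_eq_zero_of_comp_eq_comp hcomm
    (galoisRepTate_frobenius_sq_sub_smul_add_smul_eq_zero W hτ ℓ)
    (galoisRepTate_frobenius_sq_sub_smul_add_smul_eq_zero W' hτ ℓ)
  -- `f ∘ φ_ℓ ≠ 0`, `φ_ℓ = ρ(τ)` being invertible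
  have hfA : f ∘ₗ W.galoisRepTate ℓ τ ≠ 0 := by
    intro h0
    apply hf0
    calc f = (f ∘ₗ W.galoisRepTate ℓ τ) ∘ₗ W.galoisRepTate ℓ τ⁻¹ := by
          rw [LinearMap.comp_assoc, ← Module.End.mul_eq_comp, ← map_mul, mul_inv_cancel, map_one,
            Module.End.one_eq_id, LinearMap.comp_id]
      _ = 0 := by rw [h0, LinearMap.zero_comp]
  have haa : ((Nat.card K : ℤ_[ℓ]) + 1 - Nat.card W.toAffine.Point) -
      ((Nat.card K : ℤ_[ℓ]) + 1 - Nat.card W'.toAffine.Point) = 0 := by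
    by_contra hne
    refine hfA (LinearMap.ext fun x ↦ ?_)
    have hx := LinearMap.congr_fun key x
    rw [LinearMap.smul_apply, LinearMap.zero_apply] at hx
    exact (smul_eq_zero.mp hx).resolve_left hne
  have hN : (Nat.card W'.toAffine.Point : ℤ_[ℓ]) = Nat.card W.toAffine.Point := by
    linear_combination haa
  exact (Nat.cast_injective hN).symm

/-- **Isogenous elliptic curves over a finite field have the same number of rational points**,
unconditionally: `E ~ E'` over `k` finite implies `#E(k) = #E'(k)`. Tate, Invent. Math. 2 (1966),
Thm. 1 (the implication (a) ⇒ (c)); Silverman, *AEC*, Exercise 5.4(a). Proof: Silverman's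
route as machine-checked in `card_point_eq_of_isIsogenous_of` (`FaltingsECCardProofs`: `T_ℓ φ`
is injective and Frobenius-equivariant, so `tr φ_ℓ = tr φ'_ℓ`), fed with the theorem
`trace_galoisRepTate_frobenius_holds` (Thm. V.2.3.1, `tr φ_ℓ = q + 1 - #E(k)`) at a prime
`ℓ ∈ {2, 3}` different from `char k`.
[cite: Tate1966Endomorphisms, Thm. 1] [cite: SilvermanAEC2009, Exercise 5.4(a)] -/
theorem card_point_eq_of_isIsogenous [Finite K] [W.IsElliptic] [W'.IsElliptic]
    (h : W.IsIsogenous W') : Nat.card W.toAffine.Point = Nat.card W'.toAffine.Point := by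
  obtain ⟨l, hl, hlK⟩ := exists_prime_natCast_ne_zero K
  haveI : Fact l.Prime := ⟨hl⟩
  exact card_point_eq_of_isIsogenous_of (ℓ := l) (trace_galoisRepTate_frobenius_holds W l)
    (trace_galoisRepTate_frobenius_holds W' l) hlK h

/-- **Equal point counts give a non-zero `Γ_k`-map `T_ℓ E → T_ℓ E'`**, unconditionally
(`E, E'` elliptic over a finite field `k`, `ℓ ≠ char k`): the Frobenius matrices on the two
rank-`2` lattices have the same characteristic polynomial `T² - aT + q` (Thm. V.2.3.1, proved:
`trace_galoisRepTate_frobenius_holds`, `det_galoisRepTate_frobenius_holds`), hence a non-zero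
intertwiner (`exists_ne_zero_matrix_fin_two_intertwiner`), which is `Γ_k`-equivariant
(`smul_comm_of_frobenius_comm`) — the construction inside `isIsogenous_of_card_point_eq_of`
(`FaltingsECCardProofs`), stopped before Tate's theorem is invoked. For elliptic curves this is
(c) ⇒ (b) of Tate, Thm. 1.
[cite: Tate1966Endomorphisms, Thm. 1] [cite: SilvermanAEC2009, Exercise 5.4(b) with Thm. V.2.3.1] -/
theorem exists_tateModule_hom_ne_zero_of_card_point_eq [Finite K] [W.IsElliptic] [W'.IsElliptic]
    {ℓ : ℕ} [Fact ℓ.Prime] (hℓ : (ℓ : K) ≠ 0)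
    (h : Nat.card W.toAffine.Point = Nat.card W'.toAffine.Point) :
    ∃ f : W.tateModule ℓ →ₗ[ℤ_[ℓ]] W'.tateModule ℓ,
      f ≠ 0 ∧ ∀ (σ : Field.absoluteGaloisGroup K) (x : W.tateModule ℓ), f (σ • x) = σ • f x := by
  obtain ⟨τ, hτ⟩ := exists_frobenius K
  haveI := module_free_tateModule_holds W ℓ
  haveI := module_finite_tateModule_holds W ℓ
  haveI := module_free_tateModule_holds W' ℓ
  haveI := module_finite_tateModule_holds W' ℓ
  let b := Module.finBasisOfFinrankEq ℤ_[ℓ] (W.tateModule ℓ) (finrank_tateModule_eq_two_holds W ℓ hℓ)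
  let b' :=
    Module.finBasisOfFinrankEq ℤ_[ℓ] (W'.tateModule ℓ) (finrank_tateModule_eq_two_holds W' ℓ hℓ)
  have ht : (LinearMap.toMatrix b' b' (W'.galoisRepTate ℓ τ)).trace =
      (LinearMap.toMatrix b b (W.galoisRepTate ℓ τ)).trace := by
    rw [← LinearMap.trace_eq_matrix_trace ℤ_[ℓ] b, ← LinearMap.trace_eq_matrix_trace ℤ_[ℓ] b',
      trace_galoisRepTate_frobenius_holds W ℓ hℓ τ hτ,
      trace_galoisRepTate_frobenius_holds W' ℓ hℓ τ hτ, h]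
  have hd : (LinearMap.toMatrix b' b' (W'.galoisRepTate ℓ τ)).det =
      (LinearMap.toMatrix b b (W.galoisRepTate ℓ τ)).det := by
    rw [LinearMap.det_toMatrix, LinearMap.det_toMatrix, det_galoisRepTate_frobenius_holds W ℓ hℓ τ hτ,
      det_galoisRepTate_frobenius_holds W' ℓ hℓ τ hτ]
  obtain ⟨X, hX0, hX⟩ := exists_ne_zero_matrix_fin_two_intertwiner ht hd
  let f : W.tateModule ℓ →ₗ[ℤ_[ℓ]] W'.tateModule ℓ := Matrix.toLin b b' X
  have hf0 : f ≠ 0 := fun h0 ↦ hX0 ((Matrix.toLin b b').map_eq_zero_iff.mp h0)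
  have hcomm : W'.galoisRepTate ℓ τ ∘ₗ f = f ∘ₗ W.galoisRepTate ℓ τ := by
    have h1 := congrArg (Matrix.toLin b b') hX
    rw [Matrix.toLin_mul b b' b', Matrix.toLin_mul b b b', Matrix.toLin_toMatrix,
      Matrix.toLin_toMatrix] at h1
    exact h1
  have hf : ∀ x, f (τ • x) = τ • f x := fun x ↦ by
    have := LinearMap.congr_fun hcomm x
    simpa only [LinearMap.comp_apply, galoisRepTate_apply_apply] using this.symm
  exact ⟨f, hf0, smul_comm_of_frobenius_comm hτ f hf⟩

/-- **Tate, Thm. 1, (b) ⇔ (c), for elliptic curves, unconditionally**: for elliptic curves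
`E, E'` over a finite field `k` and a prime `ℓ ≠ char k`, there is a non-zero `Γ_k`-equivariant
`ℤ_ℓ`-linear map `T_ℓ E → T_ℓ E'` if and only if `#E(k) = #E'(k)` (iff the Frobenius
characteristic polynomials `T² - aT + q` agree). The remaining content of Tate's isogeny theorem
(`isIsogenous_of_finite_iff_exists_tateModule_hom_ne_zero`, `isIsogenous_iff_card_point_eq`)
is thus exactly "(b) ⇒ (a)": such a map comes from an isogeny.
[cite: Tate1966Endomorphisms, Thm. 1] [cite: SilvermanAEC2009, Exercise 5.4 with Thm. V.2.3.1] -/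
theorem exists_tateModule_hom_ne_zero_iff_card_point_eq [Finite K] [W.IsElliptic] [W'.IsElliptic]
    {ℓ : ℕ} [Fact ℓ.Prime] (hℓ : (ℓ : K) ≠ 0) :
    (∃ f : W.tateModule ℓ →ₗ[ℤ_[ℓ]] W'.tateModule ℓ,
        f ≠ 0 ∧ ∀ (σ : Field.absoluteGaloisGroup K) (x : W.tateModule ℓ),
          f (σ • x) = σ • f x) ↔
      Nat.card W.toAffine.Point = Nat.card W'.toAffine.Point :=
  ⟨fun ⟨_, hf0, hf⟩ ↦ card_point_eq_of_exists_tateModule_hom_ne_zero hf0 hf,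
    exists_tateModule_hom_ne_zero_of_card_point_eq hℓ⟩

/-! ### The converse, and the named fact, from Tate's theorem alone -/

/-- **Equal point counts ⇒ isogenous, from Tate's isogeny theorem in Tate-module form at one
prime `ℓ ≠ char k`** (the named fact `isIsogenous_of_finite_iff_exists_tateModule_hom_ne_zero W W' ℓ`
of `FaltingsEC`; only its direction `←` is used), everything else being proved
(`exists_tateModule_hom_ne_zero_of_card_point_eq`). Silverman, *AEC*, Exercise 5.4(b) with
Thm. III.7.7(a); Tate, Thm. 1.
[cite: Tate1966Endomorphisms, Thm. 1] [cite: SilvermanAEC2009, Exercise 5.4(b)] -/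
theorem isIsogenous_of_card_point_eq_of_isogenyTheorem {ℓ : ℕ} [Fact ℓ.Prime]
    (hT : isIsogenous_of_finite_iff_exists_tateModule_hom_ne_zero W W' ℓ)
    [Finite K] [W.IsElliptic] [W'.IsElliptic] (hℓ : (ℓ : K) ≠ 0)
    (h : Nat.card W.toAffine.Point = Nat.card W'.toAffine.Point) : W.IsIsogenous W' :=
  (hT hℓ).mpr (exists_tateModule_hom_ne_zero_of_card_point_eq hℓ h)

/-- **Equal point counts ⇒ isogenous, from Tate's Main Theorem at one prime `ℓ ≠ char k`** (the
root named fact `mem_span_range_tateModule_map_of_equivariant_of_finite W W' ℓ` of `FaltingsEC`: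
`Hom_k(E, E') ⊗ ℤ_ℓ → Hom_{Γ_k}(T_ℓ E, T_ℓ E')` is onto; Tate 1966, Main Theorem), via the tree's
`isIsogenous_iff_exists_tateModule_hom_ne_zero_of_finite_of_tate` (`FaltingsECIsogenyProofs`).
[cite: Tate1966Endomorphisms, Main Theorem and Thm. 1] [cite: SilvermanAEC2009, Exercise 5.4(b)] -/
theorem isIsogenous_of_card_point_eq_of_tate {ℓ : ℕ} [Fact ℓ.Prime]
    (hT : mem_span_range_tateModule_map_of_equivariant_of_finite W W' ℓ)
    [Finite K] [W.IsElliptic] [W'.IsElliptic] (hℓ : (ℓ : K) ≠ 0)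
    (h : Nat.card W.toAffine.Point = Nat.card W'.toAffine.Point) : W.IsIsogenous W' :=
  isIsogenous_of_card_point_eq_of_isogenyTheorem
    (fun hℓ' ↦ isIsogenous_iff_exists_tateModule_hom_ne_zero_of_finite_of_tate W W' ℓ hℓ' hT) hℓ h

/-- **The named fact `isIsogenous_iff_card_point_eq W W'` from Tate's isogeny theorem in
Tate-module form at one prime `ℓ ≠ char k`, alone** (`isIsogenous_iff_card_point_eq_of` of
`FaltingsECCardProofs` with the four V.2.3.1 hypotheses discharged by
`trace_galoisRepTate_frobenius_holds`, `det_galoisRepTate_frobenius_holds`).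
[cite: Tate1966Endomorphisms, Thm. 1] [cite: SilvermanAEC2009, Exercise 5.4] -/
theorem isIsogenous_iff_card_point_eq_of_isogenyTheorem {ℓ : ℕ} [Fact ℓ.Prime] (hℓ : (ℓ : K) ≠ 0)
    (hT : isIsogenous_of_finite_iff_exists_tateModule_hom_ne_zero W W' ℓ) :
    isIsogenous_iff_card_point_eq W W' :=
  isIsogenous_iff_card_point_eq_of hℓ hT (trace_galoisRepTate_frobenius_holds W ℓ)
    (det_galoisRepTate_frobenius_holds W ℓ) (trace_galoisRepTate_frobenius_holds W' ℓ)
    (det_galoisRepTate_frobenius_holds W' ℓ)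

/-- **The named fact `isIsogenous_iff_card_point_eq W W'` from Tate's isogeny theorem in
Tate-module form at all primes** (a prime `ℓ ∈ {2, 3}` different from `char k` exists,
`exists_prime_natCast_ne_zero`): the shape `isIsogenous_iff_card_point_eq_holds` takes once
`isIsogenous_of_finite_iff_exists_tateModule_hom_ne_zero_holds` exists.
[cite: Tate1966Endomorphisms, Thm. 1] [cite: SilvermanAEC2009, Exercise 5.4] -/
theorem isIsogenous_iff_card_point_eq_of_isogenyTheorem_forall
    (hT : ∀ (ℓ : ℕ) [Fact ℓ.Prime], isIsogenous_of_finite_iff_exists_tateModule_hom_ne_zero W W' ℓ) :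
    isIsogenous_iff_card_point_eq W W' := by
  intro _ _ _
  obtain ⟨l, hl, hlK⟩ := exists_prime_natCast_ne_zero K
  haveI : Fact l.Prime := ⟨hl⟩
  exact isIsogenous_iff_card_point_eq_of_isogenyTheorem hlK (hT l)

/-- **The named fact `isIsogenous_iff_card_point_eq W W'` from Tate's Main Theorem at one prime
`ℓ ≠ char k`, alone**: `isIsogenous_iff_card_point_eq_of_frobenius_facts` with the Frobenius
facts discharged. This is the sharpest reduction of the tree: of the inputs of Silverman's proof
(Exercise 5.4 via III.7.7(a), V.2.3.1, V.1.1, III.8.6, III.8.1, III.4.10(a), III.5.5, II.2.11(c))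
only Tate's theorem III.7.7(a) = [Tate 1966, Main Theorem] remains a named fact.
[cite: Tate1966Endomorphisms, Main Theorem and Thm. 1] [cite: SilvermanAEC2009, Exercise 5.4] -/
theorem isIsogenous_iff_card_point_eq_of_tate_mainTheorem {ℓ : ℕ} [Fact ℓ.Prime] (hℓ : (ℓ : K) ≠ 0)
    (hT : mem_span_range_tateModule_map_of_equivariant_of_finite W W' ℓ) :
    isIsogenous_iff_card_point_eq W W' :=
  isIsogenous_iff_card_point_eq_of_frobenius_facts hℓ hT (trace_galoisRepTate_frobenius_holds W ℓ)
    (det_galoisRepTate_frobenius_holds W ℓ) (trace_galoisRepTate_frobenius_holds W' ℓ)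
    (det_galoisRepTate_frobenius_holds W' ℓ)

/-- **The named fact `isIsogenous_iff_card_point_eq W W'` from Tate's Main Theorem at all
primes** (the shape `isIsogenous_iff_card_point_eq_holds` takes once
`mem_span_range_tateModule_map_of_equivariant_of_finite_holds` exists; a prime `ℓ ∈ {2, 3}`
different from `char k` is chosen).
[cite: Tate1966Endomorphisms, Main Theorem and Thm. 1] [cite: SilvermanAEC2009, Exercise 5.4] -/
theorem isIsogenous_iff_card_point_eq_of_tate_mainTheorem_forall
    (hT : ∀ (ℓ : ℕ) [Fact ℓ.Prime], mem_span_range_tateModule_map_of_equivariant_of_finite W W' ℓ) :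
    isIsogenous_iff_card_point_eq W W' := by
  intro _ _ _
  obtain ⟨l, hl, hlK⟩ := exists_prime_natCast_ne_zero K
  haveI : Fact l.Prime := ⟨hl⟩
  exact isIsogenous_iff_card_point_eq_of_tate_mainTheorem hlK (hT l)

/-! ### The two isogeny-theorem facts are equivalent -/

/-- **The point-count fact gives the Tate-module fact at every prime**: from
`isIsogenous_iff_card_point_eq W W'`, for any prime `ℓ` the named fact
`isIsogenous_of_finite_iff_exists_tateModule_hom_ne_zero W W' ℓ` follows (its hypothesis
`ℓ ≠ char k` and `exists_tateModule_hom_ne_zero_iff_card_point_eq`). This is the tree's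
`isIsogenous_of_finite_iff_exists_tateModule_hom_ne_zero_of_card_point_eq`
(`FaltingsECIsogenyFiniteProofs`) with its four Thm. V.2.3.1 hypotheses discharged.
[cite: Tate1966Endomorphisms, Thm. 1] -/
theorem isIsogenous_of_finite_iff_exists_tateModule_hom_ne_zero_of_isIsogenous_iff_card_point_eq
    (h : isIsogenous_iff_card_point_eq W W') (ℓ : ℕ) [Fact ℓ.Prime] :
    isIsogenous_of_finite_iff_exists_tateModule_hom_ne_zero W W' ℓ := by
  intro _ _ _ hℓ
  rw [exists_tateModule_hom_ne_zero_iff_card_point_eq hℓ]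
  exact h

/-- **The two forms of Tate's isogeny theorem for elliptic curves are equivalent named facts**:
for a prime `ℓ ≠ char k`, `isIsogenous_of_finite_iff_exists_tateModule_hom_ne_zero W W' ℓ`
(Tate-module form) holds iff `isIsogenous_iff_card_point_eq W W'` (point-count form) does.
[cite: Tate1966Endomorphisms, Thm. 1] -/
theorem isIsogenous_of_finite_iff_exists_tateModule_hom_ne_zero_iff_isIsogenous_iff_card_point_eq
    {ℓ : ℕ} [Fact ℓ.Prime] (hℓ : (ℓ : K) ≠ 0) :
    isIsogenous_of_finite_iff_exists_tateModule_hom_ne_zero W W' ℓ ↔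
      isIsogenous_iff_card_point_eq W W' :=
  ⟨isIsogenous_iff_card_point_eq_of_isogenyTheorem hℓ,
    fun h ↦ isIsogenous_of_finite_iff_exists_tateModule_hom_ne_zero_of_isIsogenous_iff_card_point_eq h ℓ⟩

end Literature.AlgebraicGeometry.Motives
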